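import Literature.NumberTheory.LFunctions.ZetaFourthMomentExplicit
import Literature.NumberTheory.LFunctions.ZetaZeroDensitySelbergExplicit
import Mathlib.Analysis.Calculus.Deriv.MeanValue
import Mathlib.Analysis.SpecialFunctions.Sqrt
import Mathlib.Analysis.SpecialFunctions.ExpDeriv
import Mathlib.Analysis.SpecialFunctions.Pow.Real
import HarnessLib

/-!
# RH-FREE — `∫₀ᵀ |ζ(½+it)|² dt ≤ T log T` for `T ≥ 10⁷` from Simonič's explicit mean square, and Chourasiya–Simonič's third-moment bound (Cor. 3) PROVED for the Table-2 rows `T₀ ≥ 10⁷` from their fourth-moment Corollary 2 by Cauchy–Schwarz («nothing here bears on the truth of RH»)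

Topic `Literature/NumberTheory/LFunctions` (RH literature-typing tranche 1, L4 "explicit zero
statistics", gen 7: the moment inputs of the explicit zero-density estimates). Label: **RH-FREE**.
THEOREMS only — NO new definition, NO new named fact (D-0026): everything is derived from the tree's
named facts `Simonic2020_cor5` (`ZetaZeroDensitySelbergExplicit.lean`) and `ChourasiyaSimonic2025_cor2b`
(`ZetaFourthMomentExplicit.lean`), taken as hypotheses. Nothing here bears on the truth of RH.

Sources. S. Chourasiya, A. Simonič, *An explicit form of Ingham's zero density estimate*,
arXiv:2507.15184v2 (2025), Corollary 3 and its proof (§2): "We have `𝓜₁(T) ≤ T log T`,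
`𝓜₂(T) ≤ (1/(2π²) + 𝔐₁(T₀)/log T + 𝔐₂(T₀)/(T log⁴T)) T log⁴T` for `T ≥ T₀ ≥ 10⁶` by [Dona–Zuniga Alterman]
for the first inequality, and by Corollary 2 for the second inequality. The result now follows by the
Cauchy–Bunyakovsky–Schwarz inequality since then `𝓜_{3/2}(T) ≤ (𝓜₁(T)𝓜₂(T))^{1/2}`"
`[corpus:paper:arxiv-2507.15184 p0008 L42–50]`. A. Simonič, J. Math. Anal. Appl. 491 (2020) 124303,
Cor. 5 (the explicit mean square, tree fact `Simonic2020_cor5`).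

## What is proved

* `Simonic2020_cor5.integral_norm_sq_le_mul_log` — **`∫₀ᵀ |ζ(½+it)|² dt ≤ T log T` for every
  `T ≥ 10⁷`**, from `Simonic2020_cor5`: in the variable `v = log T` the lower-order terms are
  `T·(−(1 + log 2π − 2γ) + g(v))` with
  `g(v) = 13.803 e^{−v/4} √(v − log 2π) + 83.964 e^{−v/2}(v − log 2π) + 2000 v e^{−v} + 3691.24 e^{−v}`
  antitone on `[16, ∞)`, `g(16.11) ≤ 1.32 < 1.4993 ≤ 1 + log 2π − 2γ` (`γ < 2/3` from Mathlib,
  `log π > 1.1396`). (The source takes this shape of bound from Dona–Zuniga Alterman's sharper mean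
  square, from `T ≥ 10⁶`; with Simonič's Cor. 5 it holds from `10⁷` — in fact from about `6·10⁶`.)
* `integral_norm_zeta_cube_le_sqrt` — the Cauchy–Bunyakovsky–Schwarz step:
  `∫₀ᵀ|ζ|² ≤ a`, `∫₀ᵀ|ζ|⁴ ≤ b` (`a, b > 0`) ⇒ `∫₀ᵀ |ζ(½+it)|³ dt ≤ √(ab)` (elementary: `x³ ≤ (λx² + x⁴/λ)/2`
  with `λ = √b/√a`).
* `ChourasiyaSimonic2025_cor3.of_cor2b` — **Corollary 3 for the rows `T₀ ∈ {10⁷, 10⁸, 10⁹, 10¹⁰, 10¹⁵, 10²⁰}`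
  of Table 2 is a THEOREM given Corollary 2 (upper half) and Simonič's mean square**: for `T ≥ T₀`,
  `∫₀ᵀ |ζ(½+it)|³ dt ≤ (1/(2π²) + 𝔐₁/log T + 𝔐₂/(T log⁴T))^{1/2} · T · log^{5/2} T`. (The row `T₀ = 10⁶`
  of the printed Cor. 3 is not covered by this route; it stays part of the named fact
  `ChourasiyaSimonic2025_cor3`.)

## References

* S. Chourasiya, A. Simonič, arXiv:2507.15184v2 (2025), Cor. 3 and its proof. [ChourasiyaSimonic2025]
* A. Simonič, J. Math. Anal. Appl. 491 (2020) 124303, Cor. 5. [Simonic2020]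
* D. Dona, S. Zuniga Alterman, J. Math. Anal. Appl. 516 (2022) 126478, Thm. 1.1 (the mean square the
  source uses; not needed here). [folklore]
-/

noncomputable section

open Complex MeasureTheory Set

open scoped Real

namespace Literature.NumberTheory.LFunctions

/-! ### Numerical constants -/

/-- `log π > 1.1396` (`e · (e^{0.0349})⁴ < 2.7182818286 · (1/0.9651)⁴ < 3.1416`). [folklore] -/
private lemma log_pi_gt_1_1396 : (1.1396 : ℝ) < Real.log π := by
  rw [Real.lt_log_iff_exp_lt Real.pi_pos]
  have h1 : Real.exp 0.0349 < 1 / (1 - 0.0349) :=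
    Real.exp_bound_div_one_sub_of_interval' (by norm_num) (by norm_num)
  have h4 : Real.exp 0.1396 = Real.exp 0.0349 ^ 4 := by
    rw [← Real.exp_nat_mul]; norm_num
  have he : Real.exp 1.1396 = Real.exp 1 * Real.exp 0.0349 ^ 4 := by
    rw [← h4, ← Real.exp_add]; norm_num
  rw [he]
  have h0 : 0 ≤ Real.exp 0.0349 := (Real.exp_pos _).le
  calc Real.exp 1 * Real.exp 0.0349 ^ 4 ≤ 2.7182818286 * Real.exp 0.0349 ^ 4 := by
        gcongr; exact Real.exp_one_lt_d9.le
    _ ≤ 2.7182818286 * (1 / (1 - 0.0349)) ^ 4 := by gcongr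
    _ < 3.141592 := by norm_num
    _ < π := Real.pi_gt_d6

/-- `1.8327 ≤ log(2π) ≤ 2`. [folklore] -/
private lemma log_two_pi_bounds : (1.8327 : ℝ) ≤ Real.log (2 * π) ∧ Real.log (2 * π) ≤ 2 := by
  constructor
  · rw [Real.log_mul (by norm_num) Real.pi_pos.ne']
    linarith [Real.log_two_gt_d9, log_pi_gt_1_1396]
  · rw [Real.log_le_iff_le_exp (by positivity)]
    have h := Real.exp_one_gt_d9
    have e2 : Real.exp 2 = Real.exp 1 ^ 2 := by rw [← Real.exp_nat_mul]; norm_num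
    rw [e2]
    nlinarith [Real.pi_lt_d2]

/-- `1.4993 ≤ 1 + log(2π) − 2γ` (`γ < 2/3`). [folklore] -/
private lemma littlewood_coeff_ge :
    (1.4993 : ℝ) ≤ 1 + Real.log (2 * π) - 2 * Real.eulerMascheroniConstant := by
  have hγ := Real.eulerMascheroniConstant_lt_two_thirds
  linarith [log_two_pi_bounds.1]

/-- Lower bounds `e^{16.11/4} ≥ 56.099`, `e^{16.11/2} ≥ 3144.9`, `e^{16.11} ≥ 9863580`. [folklore] -/
private lemma exp_v0_bounds :
    (56.099 : ℝ) ≤ Real.exp (16.11 / 4) ∧ (3144.9 : ℝ) ≤ Real.exp (16.11 / 2) ∧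
      (9863580 : ℝ) ≤ Real.exp 16.11 := by
  have h1 := Real.exp_one_gt_d9
  have e0 : (0 : ℝ) ≤ 2.7182818283 := by norm_num
  have hp : ∀ n : ℕ, Real.exp (n : ℝ) = Real.exp 1 ^ n := fun n ↦ by
    rw [← Real.exp_nat_mul]; simp
  refine ⟨?_, ?_, ?_⟩
  · have ha : Real.exp (16.11 / 4) = Real.exp (4 : ℕ) * Real.exp 0.0275 := by
      rw [← Real.exp_add]; norm_num
    rw [ha, hp]
    have hb : (1.0275 : ℝ) ≤ Real.exp 0.0275 := by linarith [Real.add_one_le_exp (0.0275 : ℝ)]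
    calc (56.099 : ℝ) ≤ 2.7182818283 ^ 4 * 1.0275 := by norm_num
      _ ≤ Real.exp 1 ^ 4 * Real.exp 0.0275 := by gcongr
  · have ha : Real.exp (16.11 / 2) = Real.exp (8 : ℕ) * Real.exp 0.055 := by
      rw [← Real.exp_add]; norm_num
    rw [ha, hp]
    have hb : (1.055 : ℝ) ≤ Real.exp 0.055 := by linarith [Real.add_one_le_exp (0.055 : ℝ)]
    calc (3144.9 : ℝ) ≤ 2.7182818283 ^ 8 * 1.055 := by norm_num
      _ ≤ Real.exp 1 ^ 8 * Real.exp 0.055 := by gcongr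
  · have ha : Real.exp 16.11 = Real.exp (16 : ℕ) * Real.exp 0.11 := by
      rw [← Real.exp_add]; norm_num
    rw [ha, hp]
    have hb : (1.11 : ℝ) ≤ Real.exp 0.11 := by linarith [Real.add_one_le_exp (0.11 : ℝ)]
    calc (9863580 : ℝ) ≤ 2.7182818283 ^ 16 * 1.11 := by norm_num
      _ ≤ Real.exp 1 ^ 16 * Real.exp 0.11 := by gcongr

/-- `e^{16.11} ≤ 10⁷`. [folklore] -/
private lemma exp_16_11_le : Real.exp 16.11 ≤ (10 : ℝ) ^ 7 := by
  have ha : Real.exp 16.11 = Real.exp (16 : ℕ) * Real.exp 0.11 := by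
    rw [← Real.exp_add]; norm_num
  have hp : Real.exp ((16 : ℕ) : ℝ) = Real.exp 1 ^ 16 := by rw [← Real.exp_nat_mul]; simp
  rw [ha, hp]
  have h1 := Real.exp_one_lt_d9
  have h2 : Real.exp 0.11 < 1 / (1 - 0.11) :=
    Real.exp_bound_div_one_sub_of_interval' (by norm_num) (by norm_num)
  have e0 : (0 : ℝ) ≤ Real.exp 1 := (Real.exp_pos 1).le
  calc Real.exp 1 ^ 16 * Real.exp 0.11 ≤ 2.7182818286 ^ 16 * (1 / (1 - 0.11)) := by
        gcongr
    _ ≤ 10 ^ 7 := by norm_num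

/-! ### The lower-order terms of Simonič's mean square are negative from `T = 10⁷` on -/

/-- In the variable `v = log T`: for `c = log 2π ∈ [1.8327, 2]` and `v ≥ 16.11`,
`13.803 e^{−v/4} √(v−c) + 83.964 e^{−v/2} (v−c) + 2000 v e^{−v} + 3691.24 e^{−v} ≤ 1.32`
(the left side is antitone in `v` on `[16, ∞)` and `≤ 1.3146` at `v = 16.11`). [folklore] -/
private lemma simonicTail_le {c v : ℝ} (hc1 : 1.8327 ≤ c) (hc2 : c ≤ 2) (hv : 16.11 ≤ v) :
    13.803 * Real.exp (-(v / 4)) * Real.sqrt (v - c) + 83.964 * Real.exp (-(v / 2)) * (v - c)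
        + 2000 * v * Real.exp (-v) + 3691.24 * Real.exp (-v) ≤ 1.32 := by
  set g : ℝ → ℝ := fun v ↦ 13.803 * Real.exp (-(v / 4)) * Real.sqrt (v - c)
      + 83.964 * Real.exp (-(v / 2)) * (v - c) + 2000 * v * Real.exp (-v) + 3691.24 * Real.exp (-v)
    with hg
  -- the derivative
  have hG : ∀ x : ℝ, 16 ≤ x → HasDerivAt g
      (Real.exp (-(x / 4)) * (13.803 * (1 / (2 * Real.sqrt (x - c)) - Real.sqrt (x - c) / 4))
        + Real.exp (-(x / 2)) * (83.964 * (1 - (x - c) / 2))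
        + Real.exp (-x) * (2000 * (1 - x) - 3691.24)) x := by
    intro x hx
    have hw : 0 < x - c := by linarith
    have h4 : HasDerivAt (fun y : ℝ ↦ Real.exp (-(y / 4))) (Real.exp (-(x / 4)) * (-(1 / 4))) x :=
      ((hasDerivAt_id' x).div_const 4).neg.exp
    have h2 : HasDerivAt (fun y : ℝ ↦ Real.exp (-(y / 2))) (Real.exp (-(x / 2)) * (-(1 / 2))) x :=
      ((hasDerivAt_id' x).div_const 2).neg.exp
    have h1 : HasDerivAt (fun y : ℝ ↦ Real.exp (-y)) (Real.exp (-x) * (-1)) x :=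
      (hasDerivAt_id' x).neg.exp
    have hs : HasDerivAt (fun y : ℝ ↦ Real.sqrt (y - c)) (1 / (2 * Real.sqrt (x - c))) x :=
      ((hasDerivAt_id' x).sub_const c).sqrt hw.ne'
    have hl : HasDerivAt (fun y : ℝ ↦ y - c) 1 x := (hasDerivAt_id' x).sub_const c
    have h := ((((h4.const_mul 13.803).mul hs).add ((h2.const_mul 83.964).mul hl)).add
      (((hasDerivAt_id' x).const_mul 2000).mul h1)).add (h1.const_mul 3691.24)
    refine h.congr_deriv ?_
    ring
  -- antitone on `[16, ∞)`
  have hanti : AntitoneOn g (Ici 16) := by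
    refine antitoneOn_of_deriv_nonpos (convex_Ici 16)
      (fun x hx ↦ (hG x hx).continuousAt.continuousWithinAt)
      (fun x hx ↦ ?_) (fun x hx ↦ ?_)
    · rw [interior_Ici] at hx
      exact (hG x (le_of_lt hx)).differentiableAt.differentiableWithinAt
    · rw [interior_Ici] at hx
      have hx' : 16 < x := hx
      rw [(hG x hx'.le).deriv]
      have hw : 0 < x - c := by linarith
      have hs0 : 0 < Real.sqrt (x - c) := Real.sqrt_pos.mpr hw
      have hs2 : Real.sqrt (x - c) ^ 2 = x - c := Real.sq_sqrt hw.le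
      have hq : 1 / (2 * Real.sqrt (x - c)) ≤ Real.sqrt (x - c) / 4 := by
        rw [div_le_div_iff₀ (by positivity) (by norm_num)]
        nlinarith
      have t1 : Real.exp (-(x / 4)) * (13.803 * (1 / (2 * Real.sqrt (x - c)) - Real.sqrt (x - c) / 4))
          ≤ 0 := mul_nonpos_of_nonneg_of_nonpos (Real.exp_pos _).le (by linarith)
      have t2 : Real.exp (-(x / 2)) * (83.964 * (1 - (x - c) / 2)) ≤ 0 :=
        mul_nonpos_of_nonneg_of_nonpos (Real.exp_pos _).le (by linarith)
      have t3 : Real.exp (-x) * (2000 * (1 - x) - 3691.24) ≤ 0 :=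
        mul_nonpos_of_nonneg_of_nonpos (Real.exp_pos _).le (by linarith)
      linarith
  -- the value at `16.11`
  have hval : g 16.11 ≤ 1.32 := by
    obtain ⟨e4, e2, e1⟩ := exp_v0_bounds
    have b4 : Real.exp (-(16.11 / 4 : ℝ)) ≤ (56.099 : ℝ)⁻¹ := by
      rw [Real.exp_neg]; exact inv_anti₀ (by norm_num) e4
    have b2 : Real.exp (-(16.11 / 2 : ℝ)) ≤ (3144.9 : ℝ)⁻¹ := by
      rw [Real.exp_neg]; exact inv_anti₀ (by norm_num) e2
    have b1 : Real.exp (-(16.11 : ℝ)) ≤ (9863580 : ℝ)⁻¹ := by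
      rw [Real.exp_neg]; exact inv_anti₀ (by norm_num) e1
    have bw : (16.11 : ℝ) - c ≤ 14.2773 := by linarith
    have bw0 : (0 : ℝ) ≤ 16.11 - c := by linarith
    have bs : Real.sqrt (16.11 - c) ≤ 3.7786 := by
      rw [Real.sqrt_le_left (by norm_num)]
      linarith
    have hs0 : 0 ≤ Real.sqrt (16.11 - c) := Real.sqrt_nonneg _
    simp only [hg]
    calc 13.803 * Real.exp (-(16.11 / 4 : ℝ)) * Real.sqrt (16.11 - c)
          + 83.964 * Real.exp (-(16.11 / 2 : ℝ)) * (16.11 - c)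
          + 2000 * 16.11 * Real.exp (-(16.11 : ℝ)) + 3691.24 * Real.exp (-(16.11 : ℝ))
        ≤ 13.803 * (56.099 : ℝ)⁻¹ * 3.7786 + 83.964 * (3144.9 : ℝ)⁻¹ * 14.2773
          + 2000 * 16.11 * (9863580 : ℝ)⁻¹ + 3691.24 * (9863580 : ℝ)⁻¹ := by
          gcongr
      _ ≤ 1.32 := by norm_num
  have hmono : g v ≤ g 16.11 :=
    hanti (show (16.11 : ℝ) ∈ Ici 16 by norm_num) (show v ∈ Ici (16 : ℝ) from by
      simp only [mem_Ici]; linarith) hv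
  have : g v = 13.803 * Real.exp (-(v / 4)) * Real.sqrt (v - c) + 83.964 * Real.exp (-(v / 2)) * (v - c)
      + 2000 * v * Real.exp (-v) + 3691.24 * Real.exp (-v) := by simp only [hg]
  linarith

/-- **`∫₀ᵀ |ζ(½+it)|² dt ≤ T log T` for every `T ≥ 10⁷`**, from Simonič's explicit mean square
`∫₀ᵀ |ζ(½+it)|² dt ≤ T log T − (1 + log 2π − 2γ)T + 13.803 T^{3/4} √(log(T/2π)) + 83.964 √T log(T/2π)
+ 2000 log T + 3691.24` (`T ≥ 2π`): the lower-order terms are `≤ (−1.4993 + 1.32)·T < 0` there. (The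
source's "`𝓜₁(T) ≤ T log T` for `T ≥ 10⁶`" is taken from Dona–Zuniga Alterman's sharper mean square;
with Simonič's Cor. 5 the inequality holds from `10⁷`.)
[cite: Simonic2020, Cor. 5] [cite: ChourasiyaSimonic2025, proof of Cor. 3] -/
theorem Simonic2020_cor5.integral_norm_sq_le_mul_log (h : Simonic2020_cor5) {T : ℝ}
    (hT : (10 : ℝ) ^ 7 ≤ T) :
    ∫ t in (0 : ℝ)..T, ‖riemannZeta (1 / 2 + t * I)‖ ^ 2 ≤ T * Real.log T := by
  have hπ : 3 < π := Real.pi_gt_three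
  have hπ' : π < 3.15 := Real.pi_lt_d2
  have hT0 : 0 < T := lt_of_lt_of_le (by norm_num) hT
  have h1 := h T (by linarith)
  obtain ⟨hc1, hc2⟩ := log_two_pi_bounds
  have hcoef := littlewood_coeff_ge
  set c := Real.log (2 * π) with hc
  have hlogdiv : Real.log (T / (2 * π)) = Real.log T - c := by
    rw [Real.log_div hT0.ne' (by positivity)]
  rw [hlogdiv] at h1
  set v := Real.log T with hv
  have hTv : Real.exp v = T := Real.exp_log hT0
  have hv16 : 16.11 ≤ v := by
    rw [hv, Real.le_log_iff_exp_le hT0]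
    exact exp_16_11_le.trans hT
  -- the powers of `T` as exponentials of `v`
  have e34 : T ^ (3 / 4 : ℝ) = T * Real.exp (-(v / 4)) := by
    rw [Real.rpow_def_of_pos hT0, ← hv]
    conv_rhs => rw [← hTv, ← Real.exp_add]
    congr 1; ring
  have e12 : Real.sqrt T = T * Real.exp (-(v / 2)) := by
    rw [Real.sqrt_eq_rpow, Real.rpow_def_of_pos hT0, ← hv]
    conv_rhs => rw [← hTv, ← Real.exp_add]
    congr 1; ring
  have e1 : T * Real.exp (-v) = 1 := by
    rw [← hTv, ← Real.exp_add]; simp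
  rw [e34, e12] at h1
  have htail := simonicTail_le hc1 hc2 hv16
  have hE : 13.803 * (T * Real.exp (-(v / 4))) * Real.sqrt (v - c)
        + 83.964 * (T * Real.exp (-(v / 2))) * (v - c) + 2000 * v + 3691.24 =
      T * (13.803 * Real.exp (-(v / 4)) * Real.sqrt (v - c) + 83.964 * Real.exp (-(v / 2)) * (v - c)
        + 2000 * v * Real.exp (-v) + 3691.24 * Real.exp (-v)) := by
    linear_combination (-(2000 * v + 3691.24)) * e1
  have hET : 13.803 * (T * Real.exp (-(v / 4))) * Real.sqrt (v - c)
        + 83.964 * (T * Real.exp (-(v / 2))) * (v - c) + 2000 * v + 3691.24 ≤ T * 1.32 := by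
    rw [hE]; exact mul_le_mul_of_nonneg_left htail hT0.le
  have hC : 1.4993 * T ≤ (1 + c - 2 * Real.eulerMascheroniConstant) * T :=
    mul_le_mul_of_nonneg_right hcoef hT0.le
  linarith

/-! ### Cauchy–Bunyakovsky–Schwarz and Corollary 3 -/

/-- `t ↦ ‖ζ(½ + it)‖` is continuous (`ζ` is differentiable away from `s = 1`). [folklore] -/
private lemma continuous_norm_zeta_half_line :
    Continuous fun t : ℝ ↦ ‖riemannZeta (1 / 2 + t * I)‖ := by
  refine Continuous.norm ?_
  have hne : ∀ t : ℝ, (1 / 2 : ℂ) + t * I ≠ 1 := by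
    intro t ht
    have := congrArg Complex.re ht
    norm_num at this
  have hlin : Continuous fun t : ℝ ↦ (1 / 2 : ℂ) + t * I := by fun_prop
  exact continuous_iff_continuousAt.mpr fun t ↦
    (differentiableAt_riemannZeta (hne t)).continuousAt.comp (f := fun t : ℝ ↦ (1 / 2 : ℂ) + t * I)
      hlin.continuousAt

/-- **The Cauchy–Bunyakovsky–Schwarz step of the proof of Corollary 3**: if
`∫₀ᵀ |ζ(½+it)|² dt ≤ a` and `∫₀ᵀ |ζ(½+it)|⁴ dt ≤ b` with `a, b > 0` and `T ≥ 0`, then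
`∫₀ᵀ |ζ(½+it)|³ dt ≤ √(ab)` (elementary: `x³ ≤ (λx² + x⁴/λ)/2` pointwise with `λ = √b/√a`).
[cite: ChourasiyaSimonic2025, proof of Cor. 3] -/
theorem integral_norm_zeta_cube_le_sqrt {T a b : ℝ} (hT : 0 ≤ T) (ha : 0 < a) (hb : 0 < b)
    (h2 : ∫ t in (0 : ℝ)..T, ‖riemannZeta (1 / 2 + t * I)‖ ^ 2 ≤ a)
    (h4 : ∫ t in (0 : ℝ)..T, ‖riemannZeta (1 / 2 + t * I)‖ ^ 4 ≤ b) :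
    ∫ t in (0 : ℝ)..T, ‖riemannZeta (1 / 2 + t * I)‖ ^ 3 ≤ Real.sqrt (a * b) := by
  set f : ℝ → ℝ := fun t ↦ ‖riemannZeta (1 / 2 + t * I)‖ with hf
  have hfc : Continuous f := continuous_norm_zeta_half_line
  set A : ℝ := Real.sqrt a with hA
  set B : ℝ := Real.sqrt b with hB
  have hA0 : 0 < A := Real.sqrt_pos.mpr ha
  have hB0 : 0 < B := Real.sqrt_pos.mpr hb
  have ha2 : a = A ^ 2 := (Real.sq_sqrt ha.le).symm
  have hb2 : b = B ^ 2 := (Real.sq_sqrt hb.le).symm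
  set l : ℝ := B / A with hl
  have hl0 : 0 < l := div_pos hB0 hA0
  -- pointwise AM–GM
  have hpt : ∀ t ∈ Icc 0 T, f t ^ 3 ≤ l / 2 * f t ^ 2 + 1 / (2 * l) * f t ^ 4 := by
    intro t _
    have key : l / 2 * f t ^ 2 + 1 / (2 * l) * f t ^ 4 - f t ^ 3 =
        f t ^ 2 * (l - f t) ^ 2 / (2 * l) := by
      field_simp
      ring
    have : 0 ≤ f t ^ 2 * (l - f t) ^ 2 / (2 * l) := by positivity
    linarith
  have hi3 : IntervalIntegrable (fun t ↦ f t ^ 3) volume 0 T := (hfc.pow 3).intervalIntegrable _ _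
  have hi2 : IntervalIntegrable (fun t ↦ f t ^ 2) volume 0 T := (hfc.pow 2).intervalIntegrable _ _
  have hi4 : IntervalIntegrable (fun t ↦ f t ^ 4) volume 0 T := (hfc.pow 4).intervalIntegrable _ _
  have hmono := intervalIntegral.integral_mono_on hT hi3
    ((hi2.const_mul (l / 2)).add (hi4.const_mul (1 / (2 * l)))) hpt
  rw [intervalIntegral.integral_add (hi2.const_mul _) (hi4.const_mul _),
    intervalIntegral.integral_const_mul, intervalIntegral.integral_const_mul] at hmono
  have hI2 : l / 2 * (∫ t in (0 : ℝ)..T, f t ^ 2) ≤ l / 2 * a :=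
    mul_le_mul_of_nonneg_left h2 (by positivity)
  have hI4 : 1 / (2 * l) * (∫ t in (0 : ℝ)..T, f t ^ 4) ≤ 1 / (2 * l) * b :=
    mul_le_mul_of_nonneg_left h4 (by positivity)
  have hfin : l / 2 * a + 1 / (2 * l) * b = Real.sqrt (a * b) := by
    rw [Real.sqrt_mul ha.le, ← hA, ← hB, hl, ha2, hb2]
    field_simp
    ring
  linarith

/-- **Chourasiya–Simonič 2025, Corollary 3, for the Table-2 rows `T₀ ∈ {10⁷, 10⁸, 10⁹, 10¹⁰, 10¹⁵, 10²⁰}`,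
PROVED from Corollary 2 (upper half, with Table 2) and Simonič's mean square by Cauchy–Schwarz**:
for such a row `(T₀, 𝔐₁, 𝔐₂)` and every `T ≥ T₀`,
`∫₀ᵀ |ζ(½+it)|³ dt ≤ (1/(2π²) + 𝔐₁/log T + 𝔐₂/(T log⁴T))^{1/2} · T · log^{5/2} T`.
(The printed Cor. 3 also covers the row `T₀ = 10⁶`, via Dona–Zuniga Alterman's mean square; that row
is not reached here.) [cite: ChourasiyaSimonic2025, Cor. 3 and its proof, Table 2] -/
theorem ChourasiyaSimonic2025_cor3.of_cor2b (h2 : ChourasiyaSimonic2025_cor2b) (hS : Simonic2020_cor5)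
    {T₀ M₁ M₂ u v : ℝ} (hrow : (T₀, M₁, M₂, u, v) ∈ CS2025.table2) (h7 : (10 : ℝ) ^ 7 ≤ T₀)
    {T : ℝ} (hT : T₀ ≤ T) :
    ∫ t in (0 : ℝ)..T, ‖riemannZeta (1 / 2 + t * I)‖ ^ 3 ≤
      Real.sqrt (1 / (2 * π ^ 2) + M₁ / Real.log T + M₂ / (T * Real.log T ^ 4)) * T
        * Real.log T ^ (5 / 2 : ℝ) := by
  have hM : 0 ≤ M₁ ∧ 0 ≤ M₂ := by
    simp only [CS2025.table2, List.mem_cons, Prod.mk.injEq, List.not_mem_nil, or_false] at hrow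
    rcases hrow with ⟨-, rfl, rfl, -, -⟩ | ⟨-, rfl, rfl, -, -⟩ | ⟨-, rfl, rfl, -, -⟩ | ⟨-, rfl, rfl, -, -⟩
      | ⟨-, rfl, rfl, -, -⟩ | ⟨-, rfl, rfl, -, -⟩ | ⟨-, rfl, rfl, -, -⟩ | ⟨-, rfl, rfl, -, -⟩
      | ⟨-, rfl, rfl, -, -⟩ <;> norm_num
  obtain ⟨hM1, hM2⟩ := hM
  have hπ : 3 < π := Real.pi_gt_three
  have hT7 : (10 : ℝ) ^ 7 ≤ T := h7.trans hT
  have hT0 : 0 < T := lt_of_lt_of_le (by norm_num) hT7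
  set L := Real.log T with hL
  have hL16 : 16.11 ≤ L := by
    rw [hL, Real.le_log_iff_exp_le hT0]
    exact exp_16_11_le.trans hT7
  have hL0 : 0 < L := by linarith
  have hl2 : Real.log (T / 2) ≤ L := Real.log_le_log (by positivity) (by linarith)
  have hl20 : 0 ≤ Real.log (T / 2) := Real.log_nonneg (by linarith)
  -- the two moment bounds
  have ha := Simonic2020_cor5.integral_norm_sq_le_mul_log hS hT7
  have h4 := (h2 T₀ M₁ M₂ u v hrow T hT).2
  set X : ℝ := 1 / (2 * π ^ 2) + M₁ / L + M₂ / (T * L ^ 4) with hX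
  have hX0 : 0 < X := by positivity
  have hb : ∫ t in (0 : ℝ)..T, ‖riemannZeta (1 / 2 + t * I)‖ ^ 4 ≤ X * T * L ^ 4 := by
    have e : X * T * L ^ 4 = 1 / (2 * π ^ 2) * T * L ^ 4 + M₁ * T * L ^ 3 + M₂ := by
      rw [hX]; field_simp
    rw [e]
    have g1 : 1 / (2 * π ^ 2) * T * Real.log (T / 2) ^ 4 ≤ 1 / (2 * π ^ 2) * T * L ^ 4 := by gcongr
    have g2 : M₁ * T * Real.log (T / 2) ^ 3 ≤ M₁ * T * L ^ 3 := by gcongr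
    linarith
  have hTL : 0 < T * L := mul_pos hT0 hL0
  have hbpos : 0 < X * T * L ^ 4 := by positivity
  have hcs := integral_norm_zeta_cube_le_sqrt hT0.le hTL hbpos ha hb
  -- `√(T L · X T L⁴) = √X · T · L^{5/2}`
  have hprod : T * L * (X * T * L ^ 4) = (T * L ^ 2) ^ 2 * (X * L) := by ring
  have hL52 : L ^ (5 / 2 : ℝ) = L ^ 2 * Real.sqrt L := by
    rw [show (5 / 2 : ℝ) = 2 + 1 / 2 by norm_num, Real.rpow_add hL0, Real.rpow_two,
      Real.sqrt_eq_rpow]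
  rw [hprod, Real.sqrt_mul (sq_nonneg _), Real.sqrt_sq (by positivity), Real.sqrt_mul hX0.le] at hcs
  rw [hL52]
  calc ∫ t in (0 : ℝ)..T, ‖riemannZeta (1 / 2 + t * I)‖ ^ 3
      ≤ T * L ^ 2 * (Real.sqrt X * Real.sqrt L) := hcs
    _ = Real.sqrt X * T * (L ^ 2 * Real.sqrt L) := by ring

end Literature.NumberTheory.LFunctions
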